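import Literature.MathematicalPhysics.QuantumFieldTheory.Balaban1983to89.T3ExistSplit
import Literature.MathematicalPhysics.QuantumFieldTheory.Balaban1983to89.T3LowerAlongMinimisersSplit
import Literature.MathematicalPhysics.QuantumFieldTheory.Balaban1983to89.T3PrintedMinimiserExistence
import HarnessLib

/-!
# `AlphaInputsT3ACMinimiserPinThm1` — CROSS-LINK (C2) OF OWNER RULING g21-№4 §C: the displayed [7] row of the 2′ pin, `T3PrintedMinimiserExistence.Thm1GlobalMinAt`,
# FROM THE TWO SCHEMAS 19200's REGISTERED COMPOSITION ALREADY YIELDS — attainment over (6) (`T3ExistSplit.MinSixAttainedAt`) and «minimisers over (6) lie in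
# (8)» (`T3LowerAlongMinimisersSplit.MinimisersIn8At`) — with the antitone bookkeeping in `(a₀, a₁)` — lane `pub-balaban3d`, seat alpha-1 (g6)

Cell `ym3-torus`, route `UnitScaleTilt`.  19200's line (`Cruxes/MinimiserStabilityRegPr/Lines/birth_v7.lean`, `variational_of_leaves_log`) produces, from its stubs and
landed leaves, `MinSixAttainedAt L â₀ â₁ B₃ ∧ MinimisersIn8At L a₀ a₁ B₃` (two windows, one `B₃`); the 2′ pin (`…MinimiserPinTriv`, `…MinimiserPinKnit`) displays
`Thm1GlobalMinAt L a₀ a₁ B₃`.  Owner ruling g21-№4 §C: do NOT staff `Thm1GlobalMinAt` separately — it follows in two lines; this file lands them: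
`thm1GlobalMinAt_of_attained_of_in8` (same window), the antitone lemmas of the three schemas in `(a₀, a₁)`, and `thm1GlobalMinAt_min_of_attained_of_in8`
(`Thm1GlobalMinAt L (min â₀ a₀) (min â₁ a₁) B₃` from the two schemas at their own windows).  So (D5) of 2′ closes the day 19200's stubs close: 19200 and 2′
share the [7] variational engine ONCE.
HONEST FRAMING.  Bookkeeping only (restriction of quantifiers); nothing of [Balaban1985Variational] is proved; count-neutral; not a claim about the continuum limit or
the mass gap.
References: T. Bałaban, Commun. Math. Phys. 102 (1985) 277–309 [Balaban1985Variational], Thm 1 (6)–(8) pp. 278–279, Prop 7 p. 299, Prop 8 p. 304.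
-/

set_option autoImplicit false

noncomputable section

namespace Summit.QuantumFields.YangMills.Theorems.MinimiserPin

open Literature.MathematicalPhysics.QuantumFieldTheory.Balaban1983to89
open Literature.MathematicalPhysics.QuantumFieldTheory.Balaban1983to89.T3ContinuumYM3Torus
open Literature.MathematicalPhysics.QuantumFieldTheory.Balaban1983to89.T3PrintedRegularMinimiser (regFibrePr)
open Literature.MathematicalPhysics.QuantumFieldTheory.Balaban1983to89.T3PrintedMinimiserExistence (Thm1GlobalMinAt)
open Literature.MathematicalPhysics.QuantumFieldTheory.Balaban1983to89.T3ExistSplit (MinSixAttainedAt)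
open Literature.MathematicalPhysics.QuantumFieldTheory.Balaban1983to89.T3LowerAlongMinimisersSplit (MinimisersIn8At)

/-- ★ **[7] THM 1 (GLOBAL READING) FROM ATTAINMENT OVER (6) AND «MINIMISERS OVER (6) LIE IN (8)»**, at one window `(a₀, a₁, B₃)`: the minimiser over the space
(6) at `ε₀` that `MinSixAttainedAt` provides lies in the space (8) at `B₃ε₁` by `MinimisersIn8At`. [cite: Balaban1985Variational, Thm 1 (8) p.279, Prop 7 p.299 and Prop 8 p.304] -/
theorem thm1GlobalMinAt_of_attained_of_in8 {L : ℕ} {a₀ a₁ B₃ : ℝ} (hatt : MinSixAttainedAt L a₀ a₁ B₃) (hin8 : MinimisersIn8At L a₀ a₁ B₃) :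
    Thm1GlobalMinAt L a₀ a₁ B₃ := by
  intro F hF n K hnK ε₁ ε₀ h₁ h₂ h₃ h₄ V hV
  obtain ⟨U, hU, hmin⟩ := hatt F hF n K hnK ε₁ ε₀ h₁ h₂ h₃ h₄ V hV
  exact ⟨U, hin8 F hF n K hnK ε₁ ε₀ h₁ h₂ h₃ h₄ V hV U hU hmin, hmin⟩

/-- `MinSixAttainedAt` is ANTITONE in `(a₀, a₁)` (fewer admissible pairs). [cite: Balaban1985Variational, Prop 7 p.299 (bookkeeping)] -/
theorem minSixAttainedAt_anti {L : ℕ} {a₀ a₁ a₀' a₁' B₃ : ℝ} (h : MinSixAttainedAt L a₀ a₁ B₃) (ha₀ : a₀' ≤ a₀) (ha₁ : a₁' ≤ a₁) :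
    MinSixAttainedAt L a₀' a₁' B₃ :=
  fun F hF n K hnK ε₁ ε₀ h₁ h₂ h₃ h₄ V hV => h F hF n K hnK ε₁ ε₀ h₁ (h₂.trans ha₁) h₃ (h₄.trans ha₀) V hV

/-- `MinimisersIn8At` is ANTITONE in `(a₀, a₁)`. [cite: Balaban1985Variational, Prop 8 p.304 (bookkeeping)] -/
theorem minimisersIn8At_anti {L : ℕ} {a₀ a₁ a₀' a₁' B₃ : ℝ} (h : MinimisersIn8At L a₀ a₁ B₃) (ha₀ : a₀' ≤ a₀) (ha₁ : a₁' ≤ a₁) :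
    MinimisersIn8At L a₀' a₁' B₃ :=
  fun F hF n K hnK ε₁ ε₀ h₁ h₂ h₃ h₄ V hV => h F hF n K hnK ε₁ ε₀ h₁ (h₂.trans ha₁) h₃ (h₄.trans ha₀) V hV

/-- `Thm1GlobalMinAt` is ANTITONE in `(a₀, a₁)` (with `…MinimiserPinConsts.thm1GlobalMinAt_mono` it is also monotone in `B₃`). [cite: Balaban1985Variational, Thm 1 p.279 (bookkeeping)] -/
theorem thm1GlobalMinAt_anti {L : ℕ} {a₀ a₁ a₀' a₁' B₃ : ℝ} (h : Thm1GlobalMinAt L a₀ a₁ B₃) (ha₀ : a₀' ≤ a₀) (ha₁ : a₁' ≤ a₁) :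
    Thm1GlobalMinAt L a₀' a₁' B₃ :=
  fun F hF n K hnK ε₁ ε₀ h₁ h₂ h₃ h₄ V hV => h F hF n K hnK ε₁ ε₀ h₁ (h₂.trans ha₁) h₃ (h₄.trans ha₀) V hV

/-- ★★ **[7] THM 1 (GLOBAL READING) AT THE COMMON WINDOW**: attainment over (6) at `(â₀, â₁, B₃)` and «minimisers in (8)» at `(a₀, a₁, B₃)` — the shape 19200's
`variational_of_leaves_log` delivers — give `Thm1GlobalMinAt L (min â₀ a₀) (min â₁ a₁) B₃` (two restrictions and `thm1GlobalMinAt_of_attained_of_in8`).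
[cite: Balaban1985Variational, Thm 1 (8) p.279, Prop 7 p.299 and Prop 8 p.304] -/
theorem thm1GlobalMinAt_min_of_attained_of_in8 {L : ℕ} {â₀ â₁ a₀ a₁ B₃ : ℝ} (hatt : MinSixAttainedAt L â₀ â₁ B₃) (hin8 : MinimisersIn8At L a₀ a₁ B₃) :
    Thm1GlobalMinAt L (min â₀ a₀) (min â₁ a₁) B₃ :=
  thm1GlobalMinAt_of_attained_of_in8 (minSixAttainedAt_anti hatt (min_le_left _ _) (min_le_left _ _))
    (minimisersIn8At_anti hin8 (min_le_right _ _) (min_le_right _ _))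

/-- The common window keeps the side conditions: `0 < min â₁ a₁` and `B₃·min â₁ a₁ ≤ min â₀ a₀` from `0 < â₁, a₁`, `B₃â₁ ≤ â₀`, `B₃a₁ ≤ a₀`, `0 ≤ B₃` (bookkeeping for the
record's `0 < a₁ ∧ B₃a₁ ≤ a₀`). [cite: Balaban1985Variational, Thm 1 p.279 (bookkeeping)] -/
theorem min_window_side {â₀ â₁ a₀ a₁ B₃ : ℝ} (hB₃ : 0 ≤ B₃) (hâ₁ : 0 < â₁) (ha₁ : 0 < a₁) (hâ : B₃ * â₁ ≤ â₀) (ha : B₃ * a₁ ≤ a₀) :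
    0 < min â₁ a₁ ∧ B₃ * min â₁ a₁ ≤ min â₀ a₀ := by
  refine ⟨lt_min hâ₁ ha₁, le_min ?_ ?_⟩
  · exact (mul_le_mul_of_nonneg_left (min_le_left _ _) hB₃).trans hâ
  · exact (mul_le_mul_of_nonneg_left (min_le_right _ _) hB₃).trans ha

end Summit.QuantumFields.YangMills.Theorems.MinimiserPin

end
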